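import Literature.NumberTheory.GaloisRepresentations.DeRhamLAdicCharacterHeckeRat
import Literature.NumberTheory.GaloisRepresentations.PadicEmbeddingPlaces
import HarnessLib

/-!
# A de Rham `ℓ`-adic character of `Γ_K` comes from an algebraic Hecke character, for every prime
# `ℓ` that splits completely in `K` (unconditional)

Topic `NumberTheory/GaloisRepresentations`; namespace `Literature.NumberTheory.GaloisRepresentations`.
Proof file (theorems only; no definition, no named fact, no instance).

`DeRhamLAdicCharacterHeckeRat` proved the `K = ℚ` instance of the named fact
`FramedGaloisRep.exists_heckeCharacter_of_isDeRhamFramed` (Patrikis Prop. 2.2.1: a continuous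
`ψ : Γ_K → ℚ̄_ℓ^×` de Rham at every `v ∣ ℓ` comes from an algebraic Hecke character) by feeding the
reduction `FramedGaloisRep.exists_heckeCharacter_of_local_at` (local algebraicity at the places
`v ∣ ℓ` of `K` suffices) with Tate's theorem in DEGREE ONE
(`PAdicHodge.DeRhamRankOne.exists_isOpen_eq_prod_of_isDeRhamFramed`: over an `ℓ`-adic field `F`
with `𝒪_F/ℓ = 𝔽_ℓ`, `ℓ` a uniformiser and `ℚ_ℓ → F` onto, a de Rham rank-one representation is
locally algebraic).  The same local theorem applies at EVERY place of degree one: for a number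
field `K` and a place `v ∣ ℓ` with `e(v|ℓ) = f(v|ℓ) = 1`, the completion `K_v` is `ℚ_ℓ`
(`Automorphic.exists_ringEquiv_adicCompletion_of_ramificationIdx_eq_one_of_inertiaDeg_eq_one`
gives `𝒪_v ≃ 𝒪_{ℚ,(ℓ)} ≃ ℤ_ℓ`, hence residue field `𝔽_ℓ` and uniformiser `ℓ`;
`LocalField.bijective_algebraMap_adicCompletionPadicAlgebra` gives `ℚ_ℓ → K_v` onto; and
`PadicEmbedding.exists_continuous_ringHom_adicCompletion` a continuous `K_v → ℚ̄_ℓ`).  Hence: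

* `exists_isOpen_eq_prod_of_isDeRhamFramed_of_degree_one` — at a place `v ∣ ℓ` of degree one, a
  de Rham `ρ : Γ_{K_v} → GL₁(ℚ̄_ℓ)` (pinned datum) is locally algebraic on inertia;
* ★★★ `FramedGaloisRep.exists_heckeCharacter_of_isDeRhamFramed_of_splits` — **rank-one
  Fontaine–Mazur for EVERY number field `K` at every prime `ℓ` that splits completely in `K`**
  (all `v ∣ ℓ` of degree one): a continuous `ψ : Γ_K → ℚ̄_ℓ^×` de Rham at every `v ∣ ℓ` for the
  pinned datum comes from an algebraic Hecke character `χ` of `K`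
  (`Frob_v ↦ ι⁻¹(χ(ϖ_v))⁻¹` for almost all `v`) — unconditionally; by Chebotarev such `ℓ` have
  density `1/[K̃ : ℚ]`, so every number field has infinitely many.

Citations: Serre, *Abelian ℓ-adic representations* (1968), Ch. III §2.3 Thm. 2 and App. A
[SerreAbelianLadic1968]; Tate, *p-divisible groups* (1967), §3.3 Thm. 2 [Tate1967]; Patrikis (2019)
Prop. 2.2.1 [Patrikis2019]; Neukirch, ANT Ch. II (8.?) (local degree `e f`) [NeukirchANT1999].
-/

noncomputable section

open scoped NumberField Topology Polynomial
open NumberField IsDedekindDomain IsDedekindDomain.HeightOneSpectrum Filter Field Polynomial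

namespace Literature.NumberTheory.GaloisRepresentations

/-- **At a place of degree one, de Rham rank-one representations are locally algebraic.**  For a
number field `K`, a prime `ℓ`, a place `v ∣ ℓ` with `e(v|ℓ) = f(v|ℓ) = 1` and a continuous
`ρ : Γ_{K_v} → GL₁(ℚ̄_ℓ)` de Rham for the pinned datum `fontainePstAdicCompletion v ℓ hv`, there are
an open `V ≤ K_v^×`, finitely many continuous embeddings `e : K_v → ℚ̄_ℓ` and exponents `n_e` with
`ρ(w) = ∏ e(Art w)^{n_e}` for all inertial `w` with `Art w ∈ V` (Tate's theorem in degree one,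
`PAdicHodge.DeRhamRankOne.exists_isOpen_eq_prod_of_isDeRhamFramed`, at `K_v ≅ ℚ_ℓ`).
[cite: SerreAbelianLadic1968, Ch. III App. A Cor. 2] [cite: Tate1967, §3.3 Thm. 2] -/
theorem exists_isOpen_eq_prod_of_isDeRhamFramed_of_degree_one {K : Type} [Field K] [NumberField K]
    (ℓ : ℕ) [Fact ℓ.Prime] (v : HeightOneSpectrum (𝓞 K)) (hv : ((ℓ : ℕ) : 𝓞 K) ∈ v.asIdeal)
    (he : v.asIdeal.ramificationIdx (𝓞 ℚ) = 1) (hf : v.asIdeal.inertiaDeg (𝓞 ℚ) = 1)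
    (ρ : FramedRep (absoluteGaloisGroup (v.adicCompletion K)) (PadicAlgCl ℓ) 1)
    (hρ : (PAdicHodge.fontainePstAdicCompletion v ℓ hv).IsDeRhamFramed ρ) :
    ∃ V : Subgroup (v.adicCompletion K)ˣ, IsOpen (V : Set (v.adicCompletion K)ˣ) ∧
      ∃ (s : Finset (v.adicCompletion K →+* PadicAlgCl ℓ))
        (n : (v.adicCompletion K →+* PadicAlgCl ℓ) → ℤ), (∀ e ∈ s, Continuous e) ∧
        ∀ w ∈ WeilGroup.inertia (v.adicCompletion K), canonicalArtin (v.adicCompletion K) w ∈ V →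
          ((ρ (WeilGroup.toAbsGalois (v.adicCompletion K) w) : GL (Fin 1) (PadicAlgCl ℓ)) :
              Matrix (Fin 1) (Fin 1) (PadicAlgCl ℓ)) 0 0 =
            ∏ e ∈ s, e ((canonicalArtin (v.adicCompletion K) w : (v.adicCompletion K)ˣ) :
              v.adicCompletion K) ^ n e := by
  classical
  -- the place `v₀ = (ℓ)` of `ℚ` below `v`
  let v₀ : HeightOneSpectrum (𝓞 ℚ) := v.under (𝓞 ℚ)
  haveI : v.asIdeal.LiesOver v₀.asIdeal := ⟨rfl⟩
  have hv₀ : ((ℓ : ℕ) : 𝓞 ℚ) ∈ v₀.asIdeal := LocalField.natCast_mem_under ℓ v hv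
  -- `𝒪_v ≃ 𝒪_{ℚ,v₀} ≃ ℤ_ℓ` (degree one), as ring isomorphisms
  obtain ⟨ψ, -, -, -⟩ :=
    Literature.NumberTheory.Automorphic.exists_ringEquiv_adicCompletion_of_ramificationIdx_eq_one_of_inertiaDeg_eq_one
      ℚ K v₀ v he hf
  -- `v₀` is the place of `ℓ`: identify `ℓ` with `primesEquiv v₀`
  obtain rfl : ((Rat.HeightOneSpectrum.primesEquiv v₀ : Nat.Primes) : ℕ) = ℓ :=
    LocalField.primesEquiv_eq_of_natCast_mem ℓ v₀ hv₀
  let eZ : v.adicCompletionIntegers K ≃+* ℤ_[(Rat.HeightOneSpectrum.primesEquiv v₀ : Nat.Primes)] :=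
    ψ.symm.trans (Rat.HeightOneSpectrum.adicCompletionIntegers.padicIntEquiv v₀ :
      v₀.adicCompletionIntegers ℚ ≃+* ℤ_[(Rat.HeightOneSpectrum.primesEquiv v₀ : Nat.Primes)])
  haveI := LocalField.charZero_adicCompletion v
  have hF := LocalField.valuation_adicCompletion_natCast_lt_one v
    ((Rat.HeightOneSpectrum.primesEquiv v₀ : Nat.Primes) : ℕ) hv
  have hρ' : (Literature.NumberTheory.PAdicHodge.fontainePst (v.adicCompletion K)
      ((Rat.HeightOneSpectrum.primesEquiv v₀ : Nat.Primes) : ℕ) hF).IsDeRhamFramed ρ := hρ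
  -- residue field `𝔽_ℓ` and uniformiser `ℓ`
  have hπ := Literature.NumberTheory.NumberFields.isUniformizer_natCast_adicCompletion_of_padicIntEquiv v eZ
  have hq := Literature.NumberTheory.NumberFields.residueFieldCard_adicCompletion_of_padicIntEquiv v eZ
  -- `ℚ_ℓ → K_v` is onto (local degree `e f = 1`)
  have hdeg : Function.Surjective (LocalField.padicRingHom (v.adicCompletion K)
      ((Rat.HeightOneSpectrum.primesEquiv v₀ : Nat.Primes) : ℕ) hF) :=
    (LocalField.bijective_algebraMap_adicCompletionPadicAlgebra _ v hv he hf).2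
  -- a continuous embedding `K_v → ℚ̄_ℓ`
  obtain ⟨e, hec⟩ := PadicEmbedding.exists_continuous_ringHom_adicCompletion v hv
  exact Literature.NumberTheory.PAdicHodge.DeRhamRankOne.exists_isOpen_eq_prod_of_isDeRhamFramed
    hF hπ hq hdeg e hec ρ hρ'

/-- ★★★ **Rank-one Fontaine–Mazur for every number field at every totally split prime,
unconditionally.**  Let `K` be a number field and `ℓ` a prime that splits completely in `K`
(`e(v|ℓ) = f(v|ℓ) = 1` for every `v ∣ ℓ`).  Every continuous `ψ : Γ_K → ℚ̄_ℓ^×` that is de Rham at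
every `v ∣ ℓ` (pinned Fontaine datum) comes from an algebraic Hecke character `χ` of `K`:
`χ` and `ψ` are unramified at almost all `v` and there `ψ(Frob_v)` has characteristic polynomial
`X - ι⁻¹(χ(ϖ_v))⁻¹` — the instance "at `ℓ` split" of `FramedGaloisRep.exists_heckeCharacter_of_isDeRhamFramed`
(Patrikis Prop. 2.2.1 / Serre III §2.3), via `FramedGaloisRep.exists_heckeCharacter_of_local_at` and
`exists_isOpen_eq_prod_of_isDeRhamFramed_of_degree_one`.
[cite: Patrikis2019, Prop. 2.2.1] [cite: SerreAbelianLadic1968, Ch. III §2.3 Thm. 2 and App. A Cor. 2]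
[cite: Tate1967, §3.3 Thm. 2] -/
theorem FramedGaloisRep.exists_heckeCharacter_of_isDeRhamFramed_of_splits (K : Type) [Field K]
    [NumberField K] (ℓ : ℕ) [Fact ℓ.Prime]
    (hsplit : ∀ v : HeightOneSpectrum (𝓞 K), ((ℓ : ℕ) : 𝓞 K) ∈ v.asIdeal →
      v.asIdeal.ramificationIdx (𝓞 ℚ) = 1 ∧ v.asIdeal.inertiaDeg (𝓞 ℚ) = 1)
    (ψ : FramedGaloisRep K (PadicAlgCl ℓ) 1)
    (hdR : ∀ (v : HeightOneSpectrum (𝓞 K)) (hv : ((ℓ : ℕ) : 𝓞 K) ∈ v.asIdeal),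
      (PAdicHodge.fontainePstAdicCompletion v ℓ hv).IsDeRhamFramed (ψ.toLocal v))
    (ι : PadicAlgCl ℓ ≃+* ℂ) :
    ∃ χ : HeckeCharacter K, χ.IsAlgebraic ∧
      ∀ᶠ v : HeightOneSpectrum (𝓞 K) in cofinite, χ.IsUnramifiedAt v ∧ ψ.IsUnramifiedAt v ∧
        ψ.HasFrobCharpolyAt v (X - C (ι.symm (χ.valueAtUniformizer v)⁻¹)) :=
  FramedGaloisRep.exists_heckeCharacter_of_local_at K ℓ ψ
    (fun v hv => exists_isOpen_eq_prod_of_isDeRhamFramed_of_degree_one ℓ v hv (hsplit v hv).1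
      (hsplit v hv).2 (ψ.toLocal v) (hdR v hv)) ι

end Literature.NumberTheory.GaloisRepresentations

end
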